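import Summits.Ventures.QEC.Census.GB.GB48_PK21q
import Summits.Ventures.QEC.Census.BB.BBRows
import Summits.Ventures.QEC.Census.BB.Claims
import Literature.InformationTheory.QuantumCodes.GeneralizedBicycleCodesPK21
import Literature.InformationTheory.QuantumCodes.CSSParameters
import HarnessLib

/-!
# Panteleev–Kalachev Table-1 row A3 `[[48, 6, 8]]` holds for the TYPED object `BB.pk21A3` (tier KERNEL, distance EXACT)

`BB.pk21A3 : BB.Code 24 1` is the generalized-bicycle code `GB(a, b)`, `ℓ = 24`, `a(x) = 1 + x² + x⁸ + x¹⁵`,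
`b(x) = 1 + x² + x¹² + x¹⁷` of [PanteleevKalachev2021, App. B] typed in
`Literature/InformationTheory/QuantumCodes/GeneralizedBicycleCodesPK21.lean` (printed row: Table 1, `[[48,6,8]]`, `w = 8`).
The census certified the SAME matrices as the explicit code of row `GB48_PK21q` (`Census/GB/GB48_PK21q.lean`, qec-type-07 g4,
p516236: `GB48_PK21q.isCode : (cert.code _).IsCode 48 6 8`, MITM certificate, KERNEL-std; kernel B certB ee5a1e0a46726499, job j258249).
This file reads that row as a statement about the typed construction, by qec-type-05's bridge pattern
(`Census/BB/BBRowsQC01.lean` …): monomial lists `la`, `lb`; `BB.pk21A3.A = polyL la`, `.B = polyL lb` (unfolding `BB.xPow`); the kernel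
INDEX IDENTITIES `GB48_PK21q.cert.HX = BBRows.rowsX la lb`, `… .HZ = rowsZ la lb` (`decide +kernel` — the census generator file
`census/search-3/gens/c3/GB48_PK21q.json` uses the convention of Bravyi et al. §4 = `BivariateBicycleCodes.lean`, `L` block = qubits
`0…23`, `R` block = `24…47`, row `i` of `x^e` ↦ column `i + e`; checked row-for-row in Python before filing); the flat identities via
`BBRows.rowMatrix_rowsX/Z`; transport of the row's `dZ_eq` and `k_eq` by `BB.Code.dZ_eq_of_flat` / `k_eq_of_flat`; assembled as
**`PK21A3_6_8_holds : BB.HasParams BB.pk21A3 48 6 8`** (`Census/BB/Claims.lean` census predicate, distance EXACT = printed `8`) and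
`isCode : BB.pk21A3.css.IsCode 48 6 8`.

No new certificate — tier KERNEL, axioms standard, no `native_decide`. HONEST FRAMING: a REPRODUCTION of the printed parameters
`[[48,6,8]]` on the typed object (the printed value was obtained by MILP/GLPK, PK21q App. B p0020); ours is an independent machine-checked
certificate chain (kernel-A certificate replayed in the Lean kernel + this transport); no novelty word. Companion of qec-search-2 g4's
`PK21A5UB` / `PK21A1UB` / `PK21A6UB` (upper-bound rows of the open-in-print PK21 codes). qec-search-2 g5.
-/

namespace Summit.Ventures.QEC.Census.PK21A3

open Matrix Literature.InformationTheory.QuantumCodes BBRows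

/-- Monomials of `BB.pk21A3.A = 1 + x² + x⁸ + x¹⁵` on `ℤ₂₄ × ℤ₁`. DATA. -/
def la : List (BB.Mono 24 1) := [(Fin.ofNat 24 0, 0), (Fin.ofNat 24 2, 0), (Fin.ofNat 24 8, 0), (Fin.ofNat 24 15, 0)]

/-- Monomials of `BB.pk21A3.B = 1 + x² + x¹² + x¹⁷` on `ℤ₂₄ × ℤ₁`. DATA. -/
def lb : List (BB.Mono 24 1) := [(Fin.ofNat 24 0, 0), (Fin.ofNat 24 2, 0), (Fin.ofNat 24 12, 0), (Fin.ofNat 24 17, 0)]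

/-- `BB.pk21A3.A = polyL la` (unfolding `BB.xPow`). -/
theorem obj_A : BB.pk21A3.A = polyL la := by
  simp only [BB.pk21A3, polyL, la, List.map, List.sum_cons, List.sum_nil, add_zero, BB.xPow, add_assoc]

/-- `BB.pk21A3.B = polyL lb`. -/
theorem obj_B : BB.pk21A3.B = polyL lb := by
  simp only [BB.pk21A3, polyL, lb, List.map, List.sum_cons, List.sum_nil, add_zero, BB.xPow, add_assoc]

set_option maxRecDepth 100000 in
/-- INDEX IDENTITY, `X` side, in the kernel: the census certificate's `H^X` rows ARE the `X`-check words of `BB.pk21A3`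
(`decide +kernel`). -/
theorem HX_eq_rowsX : GB48_PK21q.cert.HX = rowsX la lb := by
  decide +kernel

set_option maxRecDepth 100000 in
/-- INDEX IDENTITY, `Z` side. -/
theorem HZ_eq_rowsZ : GB48_PK21q.cert.HZ = rowsZ la lb := by
  decide +kernel

set_option maxRecDepth 100000 in
/-- The certificate's flat `H^X` is `BB.pk21A3.HXFlat`. -/
theorem rowMatrix_HX_eq : rowMatrix 48 GB48_PK21q.cert.HX = BB.pk21A3.HXFlat := by
  have cast : ∀ {H H' : List ℕ} (e : H = H'),
      rowMatrix 48 H = (rowMatrix 48 H').submatrix (Fin.cast (congrArg List.length e)) id := by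
    intro H H' e; subst e; rfl
  exact (cast HX_eq_rowsX).trans (rowMatrix_rowsX BB.pk21A3 (LA := la) (LB := lb) obj_A obj_B)

set_option maxRecDepth 100000 in
/-- The certificate's flat `H^Z` is `BB.pk21A3.HZFlat`. -/
theorem rowMatrix_HZ_eq : rowMatrix 48 GB48_PK21q.cert.HZ = BB.pk21A3.HZFlat := by
  have cast : ∀ {H H' : List ℕ} (e : H = H'),
      rowMatrix 48 H = (rowMatrix 48 H').submatrix (Fin.cast (congrArg List.length e)) id := by
    intro H H' e; subst e; rfl
  exact (cast HZ_eq_rowsZ).trans (rowMatrix_rowsZ BB.pk21A3 (LA := la) (LB := lb) obj_A obj_B)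

set_option maxRecDepth 100000 in
/-- `d^Z (BB.pk21A3) = 8`, transported from the census certificate (`GB48_PK21q.dZ_eq`) by `BB.Code.dZ_eq_of_flat`. -/
theorem obj_dZ : BB.pk21A3.css.dZ = 8 :=
  (BB.pk21A3.dZ_eq_of_flat (D := GB48_PK21q.cert.code GB48_PK21q.commOK_cert)
    rowMatrix_HX_eq rowMatrix_HZ_eq).symm.trans GB48_PK21q.dZ_eq

set_option maxRecDepth 100000 in
/-- `k (BB.pk21A3) = 6`, transported from the census certificate (`GB48_PK21q.k_eq`) by `BB.Code.k_eq_of_flat`. -/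
theorem obj_k : BB.pk21A3.k = 6 :=
  (BB.pk21A3.k_eq_of_flat (D := GB48_PK21q.cert.code GB48_PK21q.commOK_cert)
    rowMatrix_HX_eq rowMatrix_HZ_eq).symm.trans GB48_PK21q.k_eq

/-- **Panteleev–Kalachev Table 1 row A3: `GB(1 + x² + x⁸ + x¹⁵, 1 + x² + x¹² + x¹⁷)`, `ℓ = 24`, has parameters `[[48, 6, 8]]`**
(distance EXACT; `BB.HasParams`, the census predicate of `Census/BB/Claims.lean`) — the printed row REPRODUCED on the typed
object `BB.pk21A3`. KERNEL. -/
theorem PK21A3_6_8_holds : Summit.Ventures.QEC.BB.HasParams BB.pk21A3 48 6 8 :=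
  BB.hasParams_of_dZ (by simp only [BB.numQubits_eq]) obj_k obj_dZ

/-- The same in the generic census vocabulary: `BB.pk21A3.css.IsCode 48 6 8`. -/
theorem isCode : BB.pk21A3.css.IsCode 48 6 8 :=
  (BB.hasParams_iff_isCode (by decide)).1 PK21A3_6_8_holds

/-- Both one-sided distances of `BB.pk21A3` equal `8`. -/
theorem obj_dX_dZ : BB.pk21A3.css.dX = 8 ∧ BB.pk21A3.css.dZ = 8 :=
  BB.dX_eq_of_hasParams PK21A3_6_8_holds

end Summit.Ventures.QEC.Census.PK21A3
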